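import Mathlib.Analysis.Complex.CoveringMap
import Mathlib.Analysis.Complex.Tietze
import Mathlib.Topology.Homotopy.Lifting
import Mathlib.Analysis.SpecialFunctions.Complex.Log
import Mathlib.Analysis.Convex.Contractible
import Mathlib.Analysis.LocallyConvex.WithSeminorms
import Mathlib.Topology.Algebra.Module.LocallyConvex
import Mathlib.Topology.Connected.LocallyConnected
import Literature.Topology.PlaneTopology.JordanCurve
import HarnessLib

/-!
# Janiszewski's theorem (planar compact form), via continuous logarithms

Topic: Topology / PlaneTopology. **Janiszewski's theorem** (Pommerenke, *Boundary Behaviour of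
Conformal Maps* (1992), §1.1 p. 2; Newman, *Elements of the topology of plane sets of points*
(1964), p. 110): *let `A` and `B` be closed sets (of the sphere) whose intersection `A ∩ B` is
connected; if two points are separated neither by `A` nor by `B`, then they are not separated
by `A ∪ B`* ("separated by `A`" = in different components of the complement of `A`).
We prove the planar form for **compact** `A, B ⊆ ℂ` and points of `ℂ` (`Literature.Topology.PlaneTopology.janiszewski`), with
"`A ∩ B` connected" weakened to `IsPreconnected (A ∩ B)` (empty allowed), which is the form
used in Pommerenke's proof of Carathéodory's continuity theorem (op. cit., Thm. 2.1,
(iv) ⇒ (i)); closed unbounded sets are handled there by intersecting with a large closed disc.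

The proof is Eilenberg's (1936) logarithm criterion (Borsuk's separation criterion), entirely
elementary given Mathlib's covering-space API:

* `Janiszewski.exists_log_of_mem_connectedComponentIn` — if `x, y` lie in the same component
  of `ℂ ∖ K` (`K` closed) then `(z - x)/(z - y)` has a continuous logarithm on `K` (move `y`
  to `x` inside the component; each small step changes the function by a factor close to `1`,
  which has a principal logarithm; clopen argument);
* `Janiszewski.exists_continuous_log` — a continuous nowhere-vanishing `h : ℂ → ℂ` has a
  continuous logarithm (`ℂ` is simply connected and `exp : ℂ → ℂ ∖ {0}` is a covering map,
  Mathlib `Complex.isCoveringMapOn_exp`, `IsCoveringMapOn.existsUnique_continuousMap_lifts`);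
* `Janiszewski.not_exists_log_sub_sphere` — `z - x` has no continuous logarithm on a circle
  about `x` (the difference with `log R + i t` is a continuous `2πiℤ`-valued function of the
  angle `t ∈ [0, 2π]`, hence constant, contradicting its values at `0` and `2π`);
* `Janiszewski.not_exists_log_of_isBounded` (Borsuk) — if the component of `x` in `ℂ ∖ K`
  (`K` compact) is bounded and does not contain `y`, then `(z - x)/(z - y)` has no continuous
  logarithm on `K`: a logarithm `g`, extended to `ℂ` by Tietze, would make
  `h = e^g (z - y)` on the component and `h = z - x` off it a continuous nowhere-vanishing
  function on `ℂ` equal to `z - x` on large circles, contradicting the two previous items;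
* `Janiszewski.exists_log_union` — logarithms on `A` and on `B` of the same function glue to
  one on `A ∪ B` when `A ∩ B` is preconnected (their difference is a continuous
  `2πiℤ`-valued function on `A ∩ B`);
* `janiszewski` — combine: logarithms exist on `A` and `B`, hence on `A ∪ B`; of two distinct
  components of `ℂ ∖ (A ∪ B)` one is bounded (the exterior `{R < ‖z‖}` of a large disc is
  connected, `Literature.Topology.PlaneTopology.isConnected_setOf_lt_norm`), contradicting Borsuk's criterion.

Mathlib has none of Janiszewski / Borsuk / Eilenberg (searched `Janiszewski`, `Borsuk`,
`Eilenberg`, `connectedComponentIn .*log`); it has everything used: `connectedComponentIn`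
and its API, `ContinuousMap.exists_restrict_eq` (Tietze, `TietzeExtension ℂ`),
`Continuous.if` (pasting), `IsPreconnected.constant_of_mapsTo`,
`NormedSpace.discreteTopology_zmultiples`, `Complex.exp_eq_one_iff`.

## References

* Ch. Pommerenke, *Boundary Behaviour of Conformal Maps*, Springer (1992), §1.1 p. 2
  (Janiszewski's theorem), proof of Thm. 2.1.
* M. H. A. Newman, *Elements of the topology of plane sets of points*, CUP (1964), p. 110.
* S. Eilenberg, Transformations continues en circonférence et la topologie du plan,
  Fund. Math. 26 (1936) 61–112 (the logarithm criterion).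
-/

noncomputable section

open Set Topology Complex Metric Filter

namespace Literature.Topology.PlaneTopology

namespace Janiszewski

/-! ### Continuous logarithms of `(z - x)/(z - y)` on a closed set -/

/-- For `y` closer to `y₀` than every point of `K`, the quotient `(z - y₀)/(z - y)` has a
continuous logarithm on `K` (namely `-log (1 - (y - y₀)/(z - y₀))`, principal branch). [folklore] -/
theorem exists_log_ratio_near {K : Set ℂ} {y₀ y : ℂ} (h : ∀ z ∈ K, dist y y₀ < dist z y₀) :
    ∃ ℓ : ℂ → ℂ, ContinuousOn ℓ K ∧ ∀ z ∈ K, exp (ℓ z) = (z - y₀) / (z - y) := by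
  have hne : ∀ z ∈ K, z - y₀ ≠ 0 := fun z hz h0 ↦ by
    have := h z hz
    rw [sub_eq_zero.1 h0, dist_self] at this
    exact (dist_nonneg.trans_lt this).false
  -- `(z - y)/(z - y₀) = 1 + w` with `‖w‖ < 1`
  have hw : ∀ z ∈ K, ‖-((y - y₀) / (z - y₀))‖ < 1 := fun z hz ↦ by
    rw [norm_neg, norm_div, div_lt_one (norm_pos_iff.2 (hne z hz)), ← dist_eq_norm,
      ← dist_eq_norm]
    exact h z hz
  have hq : ∀ z ∈ K, (z - y) / (z - y₀) = 1 + -((y - y₀) / (z - y₀)) := fun z hz ↦ by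
    field_simp [hne z hz]
    ring
  refine ⟨fun z ↦ -log ((z - y) / (z - y₀)), ?_, fun z hz ↦ ?_⟩
  · refine ContinuousOn.neg (ContinuousOn.clog ?_ fun z hz ↦ ?_)
    · exact ContinuousOn.div (by fun_prop) (by fun_prop) hne
    · rw [hq z hz]
      exact mem_slitPlane_of_norm_lt_one (hw z hz)
  · have hzy : z - y ≠ 0 := by
      intro h0
      have := h z hz
      rw [sub_eq_zero.1 h0] at this
      exact (lt_irrefl _ this).elim
    rw [exp_neg, exp_log (div_ne_zero hzy (hne z hz)), inv_div]

/-- **Same component ⇒ logarithm.** If `y` lies in the connected component of `x` in the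
complement of the closed set `K ⊆ ℂ`, then `(z - x)/(z - y)` has a continuous logarithm on `K`.
(The set of such `y` is clopen in the component, by `exists_log_ratio_near`.) Eilenberg (1936);
cf. Pommerenke (1992), §1.1. [cite: PommerenkeBBCM1992, §1.1 (Janiszewski's Theorem)] -/
theorem exists_log_of_mem_connectedComponentIn {K : Set ℂ} (hK : IsClosed K) {x y : ℂ}
    (hy : y ∈ connectedComponentIn Kᶜ x) :
    ∃ g : ℂ → ℂ, ContinuousOn g K ∧ ∀ z ∈ K, exp (g z) = (z - x) / (z - y) := by
  set T : Set ℂ := {y | ∃ g : ℂ → ℂ, ContinuousOn g K ∧ ∀ z ∈ K, exp (g z) = (z - x) / (z - y)}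
    with hT
  have hx : x ∈ Kᶜ := connectedComponentIn_nonempty_iff.1 ⟨y, hy⟩
  -- transfer of logarithms between nearby points off `K`
  have step : ∀ y₀ ∈ Kᶜ, ∃ δ > 0, ∀ y', dist y' y₀ < δ → (y₀ ∈ T ↔ y' ∈ T) := by
    intro y₀ hy₀
    rcases K.eq_empty_or_nonempty with hKe | hKne
    · refine ⟨1, one_pos, fun y' _ ↦ ?_⟩
      simp [hT, hKe]
    obtain ⟨δ, hδ, hδK⟩ : ∃ δ > 0, ∀ z ∈ K, δ ≤ dist z y₀ := by
      refine ⟨infDist y₀ K, (hK.notMem_iff_infDist_pos hKne).1 hy₀, fun z hz ↦ ?_⟩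
      rw [dist_comm]; exact infDist_le_dist_of_mem hz
    refine ⟨δ, hδ, fun y' hy' ↦ ?_⟩
    obtain ⟨ℓ, hℓc, hℓ⟩ := exists_log_ratio_near (K := K) (y₀ := y₀) (y := y')
      (fun z hz ↦ hy'.trans_le (hδK z hz))
    have hzy₀ : ∀ z ∈ K, z - y₀ ≠ 0 := fun z hz h0 ↦ hy₀ (sub_eq_zero.1 h0 ▸ hz)
    constructor
    · rintro ⟨g, hgc, hg⟩
      refine ⟨fun z ↦ g z + ℓ z, hgc.add hℓc, fun z hz ↦ ?_⟩
      rw [exp_add, hg z hz, hℓ z hz, div_mul_div_cancel₀ (hzy₀ z hz)]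
    · rintro ⟨g, hgc, hg⟩
      refine ⟨fun z ↦ g z - ℓ z, hgc.sub hℓc, fun z hz ↦ ?_⟩
      have hzy' : z - y' ≠ 0 := fun h0 ↦ by
        have := hy'.trans_le (hδK z hz)
        rw [sub_eq_zero.1 h0] at this
        exact lt_irrefl _ this
      rw [exp_sub, hg z hz, hℓ z hz, div_div_div_cancel_right₀ hzy']
  -- hence `T ∩ Kᶜ` and `Tᶜ ∩ Kᶜ` are open
  have hopen : ∀ S : Set ℂ, (∀ y₀ ∈ Kᶜ, ∃ δ > 0, ∀ y', dist y' y₀ < δ → (y₀ ∈ S ↔ y' ∈ S)) →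
      IsOpen (S ∩ Kᶜ) := by
    intro S hS
    refine Metric.isOpen_iff.2 fun y₀ ⟨hy₀S, hy₀K⟩ ↦ ?_
    obtain ⟨δ, hδ, hδS⟩ := hS y₀ hy₀K
    obtain ⟨δ', hδ', hball⟩ := Metric.isOpen_iff.1 hK.isOpen_compl y₀ hy₀K
    refine ⟨min δ δ', lt_min hδ hδ', fun y' hy' ↦ ⟨?_, hball ?_⟩⟩
    · exact (hδS y' (lt_of_lt_of_le hy' (min_le_left _ _))).1 hy₀S
    · exact mem_ball.2 (lt_of_lt_of_le hy' (min_le_right _ _))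
  have hU : IsOpen (T ∩ Kᶜ) := hopen T step
  have hV : IsOpen (Tᶜ ∩ Kᶜ) := hopen Tᶜ fun y₀ hy₀ ↦ by
    obtain ⟨δ, hδ, h⟩ := step y₀ hy₀
    exact ⟨δ, hδ, fun y' hy' ↦ not_congr (h y' hy')⟩
  have hxT : x ∈ T := ⟨fun _ ↦ 0, continuousOn_const, fun z hz ↦ by
    have : z - x ≠ 0 := fun h0 ↦ hx (sub_eq_zero.1 h0 ▸ hz)
    rw [exp_zero, div_self this]⟩
  have hsub : connectedComponentIn Kᶜ x ⊆ T ∩ Kᶜ := by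
    refine isPreconnected_connectedComponentIn.subset_left_of_subset_union hU hV ?_ ?_ ?_
    · exact Set.disjoint_left.2 fun z hz hz' ↦ hz'.1 hz.1
    · intro z hz
      have hzK : z ∈ Kᶜ := connectedComponentIn_subset _ _ hz
      by_cases hzT : z ∈ T
      · exact Or.inl ⟨hzT, hzK⟩
      · exact Or.inr ⟨hzT, hzK⟩
    · exact ⟨x, mem_connectedComponentIn hx, hxT, hx⟩
  exact (hsub hy).1

/-! ### Logarithms of nowhere-vanishing functions on `ℂ`; none of `z - x` on a circle -/

/-- A continuous nowhere-vanishing function on `ℂ` has a continuous logarithm (`ℂ` is simply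
connected and `exp` is a covering map onto `ℂ ∖ {0}`). [folklore] -/
theorem exists_continuous_log {h : ℂ → ℂ} (hc : Continuous h) (h0 : ∀ z, h z ≠ 0) :
    ∃ H : ℂ → ℂ, Continuous H ∧ ∀ z, exp (H z) = h z := by
  obtain ⟨F, ⟨-, hF⟩, -⟩ := Complex.isCoveringMapOn_exp.existsUnique_continuousMap_lifts
    (f := ⟨h, hc⟩) (a₀ := 0) (e₀ := log (h 0)) (by simp [exp_log (h0 0)]) (fun a ↦ h0 a)
  exact ⟨F, F.continuous, fun z ↦ congrFun hF z⟩

/-- **`z - x` has no continuous logarithm on a circle about `x`.** [folklore] -/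
theorem not_exists_log_sub_sphere (x : ℂ) {R : ℝ} (hR : 0 < R) :
    ¬ ∃ H : ℂ → ℂ, ContinuousOn H (sphere x R) ∧ ∀ z ∈ sphere x R, exp (H z) = z - x := by
  rintro ⟨H, hHc, hH⟩
  -- the circle and the comparison function `φ t = H (x + R e^{it}) - (log R + i t)`
  set c : ℝ → ℂ := fun t ↦ x + R * exp (t * I) with hc
  have hcmem : ∀ t, c t ∈ sphere x R := fun t ↦ by
    simp [hc, norm_exp_ofReal_mul_I, hR.le]
  have hcc : Continuous c := by fun_prop
  set φ : ℝ → ℂ := fun t ↦ H (c t) - (Real.log R + t * I) with hφ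
  have hφc : Continuous φ :=
    (hHc.comp_continuous hcc hcmem).sub (by fun_prop)
  have hexpR : exp ((Real.log R : ℝ) : ℂ) = R := by
    rw [← ofReal_exp, Real.exp_log hR]
  have hφval : ∀ t, exp (φ t) = 1 := fun t ↦ by
    have h1 : exp (H (c t)) = R * exp (t * I) := by rw [hH _ (hcmem t)]; simp [hc]
    have h2 : (R : ℂ) * exp (t * I) ≠ 0 := mul_ne_zero (ofReal_ne_zero.2 hR.ne') (exp_ne_zero _)
    rw [hφ]
    dsimp only
    rw [exp_sub, h1, exp_add, hexpR, div_self h2]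
  -- `φ` takes values in the discrete set `2πiℤ`, hence is constant
  set T : Set ℂ := (AddSubgroup.zmultiples (2 * Real.pi * I) : Set ℂ) with hT
  have hTd : IsDiscrete T :=
    isDiscrete_iff_discreteTopology.2 (NormedSpace.discreteTopology_zmultiples _)
  have hmaps : MapsTo φ univ T := fun t _ ↦ by
    obtain ⟨n, hn⟩ := exp_eq_one_iff.1 (hφval t)
    rw [hT, SetLike.mem_coe, AddSubgroup.mem_zmultiples_iff]
    exact ⟨n, by rw [hn, zsmul_eq_mul]⟩
  have hconst := isPreconnected_univ.constant_of_mapsTo hTd hφc.continuousOn hmaps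
    (mem_univ 0) (mem_univ (2 * Real.pi))
  -- but `φ 0 - φ (2π) = 2πi`
  have hc2π : c (2 * Real.pi) = c 0 := by
    simp only [hc]
    push_cast
    rw [zero_mul, exp_zero, Complex.exp_two_pi_mul_I]
  have : φ 0 - φ (2 * Real.pi) = 2 * Real.pi * I := by
    simp only [hφ, hc2π]
    push_cast
    ring
  rw [hconst, sub_self] at this
  have h2π : (2 * Real.pi * I : ℂ) ≠ 0 := by simp [Real.pi_ne_zero]
  exact h2π this.symm

/-! ### Borsuk's criterion: points in different components admit no logarithm -/

/-- The frontier of a complementary component of a closed set `K ⊆ ℂ` lies in `K`. [folklore] -/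
theorem frontier_connectedComponentIn_subset {K : Set ℂ} (hK : IsClosed K) (x : ℂ) :
    frontier (connectedComponentIn Kᶜ x) ⊆ K := by
  intro a ha
  by_contra haK
  have hU : IsOpen (connectedComponentIn Kᶜ x) := hK.isOpen_compl.connectedComponentIn
  rw [hU.frontier_eq] at ha
  obtain ⟨δ, hδ, hball⟩ := Metric.isOpen_iff.1 hK.isOpen_compl a haK
  obtain ⟨b, hbU, hba⟩ := Metric.mem_closure_iff.1 ha.1 δ hδ
  have hsub : ball a δ ⊆ connectedComponentIn Kᶜ x := by
    rw [connectedComponentIn_eq hbU]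
    exact (convex_ball a δ).isPreconnected.subset_connectedComponentIn (mem_ball'.2 hba) hball
  exact ha.2 (hsub (mem_ball_self hδ))

/-- **Borsuk's separation criterion** (the direction used here). Let `K ⊆ ℂ` be compact,
`x ∉ K` with *bounded* complementary component `U`, and `y ∉ K ∪ U`. Then `(z - x)/(z - y)` has
no continuous logarithm on `K`. Eilenberg (1936); cf. Pommerenke (1992), §1.1. [cite: PommerenkeBBCM1992, §1.1 (Janiszewski's Theorem)] -/
theorem not_exists_log_of_isBounded {K : Set ℂ} (hK : IsCompact K) {x y : ℂ} (hx : x ∉ K)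
    (hb : Bornology.IsBounded (connectedComponentIn Kᶜ x))
    (hy : y ∉ connectedComponentIn Kᶜ x) (hyK : y ∉ K) :
    ¬ ∃ g : ℂ → ℂ, ContinuousOn g K ∧ ∀ z ∈ K, exp (g z) = (z - x) / (z - y) := by
  classical
  rintro ⟨g, hgc, hg⟩
  set U := connectedComponentIn Kᶜ x with hUdef
  have hxU : x ∈ U := mem_connectedComponentIn hx
  -- Tietze extension of `g`
  obtain ⟨G, hG⟩ := ContinuousMap.exists_restrict_eq hK.isClosed
    ⟨K.restrict g, continuousOn_iff_continuous_restrict.1 hgc⟩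
  have hGg : ∀ z ∈ K, G z = g z := fun z hz ↦ by
    have := congrArg (fun F : C(K, ℂ) ↦ F ⟨z, hz⟩) hG
    simpa using this
  -- the glued function
  set h : ℂ → ℂ := fun z ↦ if z ∈ U then exp (G z) * (z - y) else z - x with hh
  have hfr : ∀ a ∈ frontier {z | z ∈ U}, exp (G a) * (a - y) = a - x := by
    intro a ha
    rw [setOf_mem_eq] at ha
    have haK : a ∈ K := frontier_connectedComponentIn_subset hK.isClosed x ha
    have hay : a - y ≠ 0 := fun h0 ↦ hyK (sub_eq_zero.1 h0 ▸ haK)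
    rw [hGg a haK, hg a haK, div_mul_cancel₀ _ hay]
  have hhc : Continuous h := Continuous.if hfr (by fun_prop) (by fun_prop)
  have hh0 : ∀ z, h z ≠ 0 := fun z ↦ by
    by_cases hz : z ∈ U
    · have hzy : z - y ≠ 0 := fun h0 ↦ hy (sub_eq_zero.1 h0 ▸ hz)
      simp only [hh, if_pos hz]
      exact mul_ne_zero (exp_ne_zero _) hzy
    · have hzx : z - x ≠ 0 := fun h0 ↦ hz (sub_eq_zero.1 h0 ▸ hxU)
      simp only [hh, if_neg hz]
      exact hzx
  -- `h = z - x` on a large circle about `x`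
  obtain ⟨R, hR, hUR⟩ := hb.subset_ball_lt 0 x
  have hsph : ∀ z ∈ sphere x R, h z = z - x := fun z hz ↦ by
    have hzU : z ∉ U := fun hzU ↦ by
      have := hUR hzU
      rw [mem_ball] at this
      rw [mem_sphere] at hz
      exact (hz ▸ this).false
    simp only [hh, if_neg hzU]
  obtain ⟨Hlog, hHc, hH⟩ := exists_continuous_log hhc hh0
  exact not_exists_log_sub_sphere x hR
    ⟨Hlog, hHc.continuousOn, fun z hz ↦ by rw [hH z, hsph z hz]⟩

/-! ### Gluing logarithms on two closed sets with preconnected intersection -/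

/-- Logarithms of the same nowhere-vanishing function on closed sets `A` and `B` whose
intersection is preconnected glue (after adding a constant in `2πiℤ` on `B`) to a continuous
logarithm on `A ∪ B`. [folklore] -/
theorem exists_log_union {A B : Set ℂ} (hA : IsClosed A) (hB : IsClosed B)
    (hAB : IsPreconnected (A ∩ B)) {f gA gB : ℂ → ℂ} (hf : ∀ z ∈ B, f z ≠ 0)
    (hgA : ContinuousOn gA A) (hA' : ∀ z ∈ A, exp (gA z) = f z)
    (hgB : ContinuousOn gB B) (hB' : ∀ z ∈ B, exp (gB z) = f z) :
    ∃ g : ℂ → ℂ, ContinuousOn g (A ∪ B) ∧ ∀ z ∈ A ∪ B, exp (g z) = f z := by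
  classical
  -- the difference `gA - gB` is a constant `c ∈ 2πiℤ` on `A ∩ B`
  obtain ⟨c, hc1, hc⟩ : ∃ c : ℂ, exp c = 1 ∧ ∀ z ∈ A ∩ B, gA z = gB z + c := by
    rcases (A ∩ B).eq_empty_or_nonempty with he | ⟨z₀, hz₀⟩
    · exact ⟨0, exp_zero, fun z hz ↦ by rw [he] at hz; exact hz.elim⟩
    have hdiff : ∀ z ∈ A ∩ B, exp (gA z - gB z) = 1 := fun z hz ↦ by
      rw [exp_sub, hA' z hz.1, hB' z hz.2, div_self (hf z hz.2)]
    set T : Set ℂ := (AddSubgroup.zmultiples (2 * Real.pi * I) : Set ℂ) with hT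
    have hTd : IsDiscrete T :=
      isDiscrete_iff_discreteTopology.2 (NormedSpace.discreteTopology_zmultiples _)
    have hmaps : MapsTo (fun z ↦ gA z - gB z) (A ∩ B) T := fun z hz ↦ by
      obtain ⟨n, hn⟩ := exp_eq_one_iff.1 (hdiff z hz)
      rw [hT, SetLike.mem_coe, AddSubgroup.mem_zmultiples_iff]
      exact ⟨n, by simp only [hn, zsmul_eq_mul]⟩
    have hcont : ContinuousOn (fun z ↦ gA z - gB z) (A ∩ B) :=
      (hgA.mono inter_subset_left).sub (hgB.mono inter_subset_right)
    refine ⟨gA z₀ - gB z₀, hdiff z₀ hz₀, fun z hz ↦ ?_⟩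
    have := hAB.constant_of_mapsTo hTd hcont hmaps hz hz₀
    rw [← this]; ring
  refine ⟨fun z ↦ if z ∈ A then gA z else gB z + c, ?_, fun z hz ↦ ?_⟩
  · refine ContinuousOn.union_of_isClosed ?_ ?_ hA hB
    · exact hgA.congr fun z hz ↦ by simp [hz]
    · have hgB' : ContinuousOn (fun z ↦ gB z + c) B := hgB.add continuousOn_const
      refine hgB'.congr fun z hz ↦ ?_
      by_cases hzA : z ∈ A
      · simp [hzA, hc z ⟨hzA, hz⟩]
      · simp [hzA]
  · by_cases hzA : z ∈ A
    · simp only [if_pos hzA, hA' z hzA]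
    · have hzB : z ∈ B := hz.resolve_left hzA
      simp only [if_neg hzA, exp_add, hB' z hzB, hc1, mul_one]

/-! ### Components of the complement of a compact set -/

/-- Two *unbounded* complementary components of a compact set `K ⊆ ℂ` coincide: both contain
the connected exterior `{R < ‖z‖}` of a disc containing `K`. [folklore] -/
theorem connectedComponentIn_eq_of_not_isBounded {K : Set ℂ} (hK : IsCompact K) {x y : ℂ}
    (hx : ¬ Bornology.IsBounded (connectedComponentIn Kᶜ x))
    (hy : ¬ Bornology.IsBounded (connectedComponentIn Kᶜ y)) :
    connectedComponentIn Kᶜ x = connectedComponentIn Kᶜ y := by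
  obtain ⟨R, hKR⟩ := (isBounded_iff_subset_closedBall 0).1 hK.isBounded
  set R' := max R 0 with hR'
  have hKR' : K ⊆ closedBall 0 R' := hKR.trans (closedBall_subset_closedBall (le_max_left _ _))
  set E : Set ℂ := {z | R' < ‖z‖} with hE
  have hEc : IsPreconnected E := (isConnected_setOf_lt_norm (le_max_right _ _)).isPreconnected
  have hEK : E ⊆ Kᶜ := fun z hz hzK ↦ by
    have := hKR' hzK
    rw [mem_closedBall, dist_zero_right] at this
    exact (not_le.2 (hz : R' < ‖z‖)) this
  -- an unbounded component meets `E`, hence contains it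
  have key : ∀ x, ¬ Bornology.IsBounded (connectedComponentIn Kᶜ x) →
      E ⊆ connectedComponentIn Kᶜ x := by
    intro x hx
    obtain ⟨z, hzU, hzE⟩ : ∃ z ∈ connectedComponentIn Kᶜ x, z ∈ E := by
      by_contra hcon
      push Not at hcon
      refine hx ((isBounded_iff_subset_closedBall 0).2 ⟨R', fun z hz ↦ ?_⟩)
      rw [mem_closedBall, dist_zero_right]
      exact not_lt.1 (hcon z hz)
    rw [connectedComponentIn_eq hzU]
    exact hEc.subset_connectedComponentIn hzE hEK
  -- a point of `E` lies in both components
  have hEne : E.Nonempty := ⟨((R' + 1 : ℝ) : ℂ), by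
    simp only [hE, mem_setOf_eq, Complex.norm_real, Real.norm_eq_abs]
    rw [abs_of_nonneg (by positivity)]
    linarith⟩
  obtain ⟨z, hz⟩ := hEne
  rw [connectedComponentIn_eq (key x hx hz), connectedComponentIn_eq (key y hy hz)]

end Janiszewski

open Janiszewski in
/-- **Janiszewski's theorem** (planar compact form). Let `A, B ⊆ ℂ` be compact sets whose
intersection `A ∩ B` is preconnected (connected or empty). If the points `x, y` are separated
neither by `A` nor by `B` — `y` lies in the connected component of `x` in `ℂ ∖ A`, and in
`ℂ ∖ B` — then they are not separated by `A ∪ B`: `y` lies in the connected component of `x`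
in `ℂ ∖ (A ∪ B)`. Pommerenke, *Boundary Behaviour of Conformal Maps* (1992), §1.1 p. 2
(stated there for closed sets of `Ĉ` with `A ∩ B` connected); Newman (1964), p. 110. Proof by
Eilenberg's logarithm criterion, see the module docstring. [cite: PommerenkeBBCM1992, §1.1 (Janiszewski's Theorem)] -/
theorem janiszewski {A B : Set ℂ} (hA : IsCompact A) (hB : IsCompact B)
    (hAB : IsPreconnected (A ∩ B)) {x y : ℂ} (hyA : y ∈ connectedComponentIn Aᶜ x)
    (hyB : y ∈ connectedComponentIn Bᶜ x) : y ∈ connectedComponentIn (A ∪ B)ᶜ x := by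
  -- logarithms of `(z - x)/(z - y)` on `A`, on `B`, hence on `A ∪ B`
  have hxA : x ∈ Aᶜ := connectedComponentIn_nonempty_iff.1 ⟨y, hyA⟩
  have hxB : x ∈ Bᶜ := connectedComponentIn_nonempty_iff.1 ⟨y, hyB⟩
  have hyA' : y ∈ Aᶜ := connectedComponentIn_subset _ _ hyA
  have hyB' : y ∈ Bᶜ := connectedComponentIn_subset _ _ hyB
  obtain ⟨gA, hgA, hA'⟩ := exists_log_of_mem_connectedComponentIn hA.isClosed hyA
  obtain ⟨gB, hgB, hB'⟩ := exists_log_of_mem_connectedComponentIn hB.isClosed hyB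
  have hf : ∀ z ∈ B, (z - x) / (z - y) ≠ 0 := fun z hz ↦
    div_ne_zero (fun h0 ↦ hxB (sub_eq_zero.1 h0 ▸ hz)) (fun h0 ↦ hyB' (sub_eq_zero.1 h0 ▸ hz))
  obtain ⟨g, hgc, hg⟩ := exists_log_union hA.isClosed hB.isClosed hAB hf hgA hA' hgB hB'
  -- suppose `x` and `y` are separated by `K = A ∪ B`
  set K := A ∪ B with hKdef
  have hK : IsCompact K := hA.union hB
  have hxK : x ∉ K := fun h ↦ h.elim hxA hxB
  have hyK : y ∉ K := fun h ↦ h.elim hyA' hyB'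
  by_contra hcon
  have hne : connectedComponentIn Kᶜ x ≠ connectedComponentIn Kᶜ y := fun heq ↦
    hcon (heq ▸ mem_connectedComponentIn (F := Kᶜ) hyK)
  have hxy : x ∉ connectedComponentIn Kᶜ y := fun h ↦ hne (connectedComponentIn_eq h).symm
  -- one of the two components is bounded; apply Borsuk's criterion to it
  by_cases hbx : Bornology.IsBounded (connectedComponentIn Kᶜ x)
  · exact not_exists_log_of_isBounded hK hxK hbx hcon hyK ⟨g, hgc, hg⟩
  · by_cases hby : Bornology.IsBounded (connectedComponentIn Kᶜ y)
    · refine not_exists_log_of_isBounded hK hyK hby hxy hxK ⟨fun z ↦ -g z, hgc.neg, ?_⟩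
      intro z hz
      rw [exp_neg, hg z hz, inv_div]
    · exact hne (connectedComponentIn_eq_of_not_isBounded hK hbx hby)

/-- **Janiszewski's theorem**, with "not separated" phrased by connected sets: if `x` and `y`
lie in a preconnected set missing `A`, and in one missing `B` (`A, B` compact, `A ∩ B`
preconnected), then they lie in a preconnected set missing `A ∪ B` (namely a complementary
component). [cite: PommerenkeBBCM1992, §1.1 (Janiszewski's Theorem)] -/
theorem janiszewski' {A B : Set ℂ} (hA : IsCompact A) (hB : IsCompact B)
    (hAB : IsPreconnected (A ∩ B)) {x y : ℂ}
    (hSA : ∃ S ⊆ Aᶜ, IsPreconnected S ∧ x ∈ S ∧ y ∈ S)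
    (hSB : ∃ S ⊆ Bᶜ, IsPreconnected S ∧ x ∈ S ∧ y ∈ S) :
    ∃ S ⊆ (A ∪ B)ᶜ, IsPreconnected S ∧ x ∈ S ∧ y ∈ S := by
  obtain ⟨S, hS, hSc, hxS, hyS⟩ := hSA
  obtain ⟨S', hS', hS'c, hxS', hyS'⟩ := hSB
  have h := janiszewski hA hB hAB (hSc.subset_connectedComponentIn hxS hS hyS)
    (hS'c.subset_connectedComponentIn hxS' hS' hyS')
  exact ⟨connectedComponentIn (A ∪ B)ᶜ x, connectedComponentIn_subset _ _,
    isPreconnected_connectedComponentIn,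
    mem_connectedComponentIn (connectedComponentIn_nonempty_iff.1 ⟨y, h⟩), h⟩

end Literature.Topology.PlaneTopology
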